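import Mathlib
import Summits.Ventures.PercRepro2.WeightedRowInactive
import Summits.Ventures.PercRepro2.OneEdge

/-!
# The root edge, I: the contraction law as the `G − g` law, the eight cells of
`(v ∈ C₂, o ∈ C₂, b ∈ C₁)` on `Q`, and the two candidate 5-mark inequalities (3M) and (F)
(blind cell PercRepro2, night-3 g21, 2026-08-28; `proofs/NIGHT3-CERT.md` §30)

At a ROOT edge `g = {a₁, v}` the two pinned laws `P⁰ = p[g := 0]`, `P¹ = p[g := 1]` of g20's
two-copy row data (`WeightedRowInactive.lean`) are related by the one-edge connection lemma
(`OneEdge.conn_update_true_iff`): with `Q = {a₁ ↮ a₂}` and `Q′ = Q ∩ {a₂ ↮ v}`,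
`ω[g ↦ open] ∈ Q ⟺ ω[g ↦ closed] ∈ Q′`, and on `Q′` opening `g` leaves `C(a₂)` unchanged and
merges `C(v)` into `C(a₁)` (`mem_Q_update_true_iff`, `mem_Q_inter_conn*_update_true_iff`), so every
`P¹`-mass is a `P⁰`-mass (`prob_update_one_eq_prob_update_zero`).  The `P⁰`-masses of the
`(b ∈ C₁, o ∈ C₂)`-half of the BHK form are sums of the eight cells
`m(χ, ω, β) = P(Q, [v ∈ C₂] = χ, [o ∈ C₂] = ω, [b ∈ C₁] = β)` (`cell`, `prob_eq_sum_cells`,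
`mass_*`) and of the two `b ~ v` cells (`bvcell`: `b, v` in one cluster outside `C₁ ∪ C₂`, split by
`o ∈ C₂`).  The two CANDIDATES (defs, NOT claimed proved; `RootEdgeTheorems.lean` shows that they
imply g20's root-edge row `M ≥ Φ₁₁`, hence (ROW-23-R) and (ROW-MIN-R) on `a₃`-inactive instances):

* **(3M)** `ThreeMark`: `m(011)m(100) + m(111)m(000) ≤ m(101)m(010) + m(001)m(110)`;
* **(F)** `BVCross`: `P(Q, vH)·P(Q, oH, b~v) ≤ P(Q, vH, oH)·P(Q, b~v)`.

Census (own code, exact rationals, n ≤ 7): (3M) 0 failures / 1,361 nonzero rows, (F) 0 / 1,909;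
neither is a degree-2 consequence of the landed BHK / Harris / BK instances on the 5-mark table
(LP with a Farkas dual, §30).  Own work; standard axioms.
-/

namespace Summit.Ventures.PercRepro2

open UnionCluster

namespace CovForm

namespace RootEdge

open A3Inactive

variable {V : Type*} {E : Type*} [Fintype E] [DecidableEq E] [DecidableEq V]
  {R : Type*} [Field R] [LinearOrder R] [IsStrictOrderedRing R]

/-! ## Transfer: a `P¹`-probability as a `P⁰`-probability -/

omit [DecidableEq V] [LinearOrder R] [IsStrictOrderedRing R] in
/-- If `ω[g ↦ open] ∈ X ↔ ω[g ↦ closed] ∈ Y` for every `ω`, then `P¹(X) = P⁰(Y)`. -/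
lemma prob_update_one_eq_prob_update_zero (p : E → R) (g : E) {X Y : Set (Config E)}
    (h : ∀ ω : Config E, Function.update ω g true ∈ X ↔ Function.update ω g false ∈ Y) :
    prob (Function.update p g 1) X = prob (Function.update p g 0) Y := by
  rw [prob_eq_expect_indicator, prob_eq_expect_indicator, expect_update_one, expect_update_zero]
  refine congrArg _ (funext fun ω => ?_)
  by_cases hX : Function.update ω g true ∈ X
  · rw [Set.indicator_of_mem hX, Set.indicator_of_mem ((h ω).1 hX), Pi.one_apply, Pi.one_apply]
  · rw [Set.indicator_of_notMem hX, Set.indicator_of_notMem (fun hY => hX ((h ω).2 hY))]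

/-! ## The connection relation of `ω[g ↦ open]` at a root edge `g = {a₁, v}` -/

omit [Fintype E] [DecidableEq V] in
/-- Opening `g = {a₁, v}`: `a₁ ↔ x` iff `a₁ ↔ x` or `v ↔ x` before. -/
lemma conn_a₁_update_true_iff {ends : E → Sym2 V} {g : E} {a₁ v : V} (hg : ends g = s(a₁, v))
    (ω : Config E) (x : V) :
    Conn ends (Function.update ω g true) a₁ x ↔ Conn ends ω a₁ x ∨ Conn ends ω v x := by
  rw [OneEdge.conn_update_true_iff hg]
  constructor
  · rintro (h | ⟨_, h⟩ | ⟨h1, h2⟩)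
    · exact Or.inl h
    · exact Or.inr h
    · exact Or.inl h2
  · rintro (h | h)
    · exact Or.inl h
    · exact Or.inr (Or.inl ⟨conn_refl _ _ _, h⟩)

omit [Fintype E] [DecidableEq V] in
/-- `ω[g ↦ open] ∈ Q` iff `ω ∈ Q` and `a₂ ↮ v` in `ω`. -/
lemma mem_Q_update_true_iff {ends : E → Sym2 V} {g : E} {a₁ v : V} (hg : ends g = s(a₁, v))
    (ω : Config E) (a₂ : V) :
    Function.update ω g true ∈ avoidAll ends a₂ {a₁} ↔
      ω ∈ avoidAll ends a₂ {a₁} ∧ ¬ Conn ends ω a₂ v := by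
  simp only [mem_avoidAll, Finset.mem_singleton, forall_eq]
  rw [OneEdge.conn_update_true_iff hg]
  constructor
  · intro h
    exact ⟨fun h1 => h (Or.inl h1), fun h2 => h (Or.inr (Or.inr ⟨h2, conn_refl _ _ _⟩))⟩
  · rintro ⟨h1, h2⟩ (h | ⟨h3, _⟩ | ⟨h3, _⟩)
    · exact h1 h
    · exact h1 h3
    · exact h2 h3

/-! ## The membership transfers of the seven masses -/

omit [Fintype E] [DecidableEq V] in
/-- On `Q′ = Q ∩ {a₂ ↮ v}`, opening `g` does not change the cluster of `a₂`. -/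
lemma conn_a₂_update_true_iff_of_Q' {ends : E → Sym2 V} {g : E} {a₁ v : V} (hg : ends g = s(a₁, v))
    {ω : Config E} {a₂ : V} (hQ : ω ∈ avoidAll ends a₂ {a₁}) (hv : ¬ Conn ends ω a₂ v) (x : V) :
    Conn ends (Function.update ω g true) a₂ x ↔ Conn ends ω a₂ x := by
  rw [OneEdge.conn_update_true_iff hg]
  have h21 : ¬ Conn ends ω a₂ a₁ := by
    simpa only [mem_avoidAll, Finset.mem_singleton, forall_eq] using hQ
  constructor
  · rintro (h | ⟨h, _⟩ | ⟨h, _⟩)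
    · exact h
    · exact absurd h h21
    · exact absurd h hv
  · exact fun h => Or.inl h

omit [Fintype E] [DecidableEq V] in
/-- `ω[g ↦ open] ∈ Q ∩ {a₂ ↔ x}` iff `ω ∈ Q′ ∩ {a₂ ↔ x}`. -/
lemma mem_Q_inter_connH_update_true_iff {ends : E → Sym2 V} {g : E} {a₁ v : V}
    (hg : ends g = s(a₁, v)) (ω : Config E) (a₂ x : V) :
    Function.update ω g true ∈ avoidAll ends a₂ {a₁} ∩ connEvent ends a₂ x ↔
      ω ∈ avoidAll ends a₂ {a₁} ∧ ¬ Conn ends ω a₂ v ∧ Conn ends ω a₂ x := by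
  rw [Set.mem_inter_iff, mem_Q_update_true_iff hg, mem_connEvent]
  constructor
  · rintro ⟨⟨hQ, hv⟩, hx⟩
    exact ⟨hQ, hv, (conn_a₂_update_true_iff_of_Q' hg hQ hv x).1 hx⟩
  · rintro ⟨hQ, hv, hx⟩
    exact ⟨⟨hQ, hv⟩, (conn_a₂_update_true_iff_of_Q' hg hQ hv x).2 hx⟩

omit [Fintype E] [DecidableEq V] in
/-- `ω[g ↦ open] ∈ Q ∩ {a₁ ↔ x}` iff `ω ∈ Q′` and (`a₁ ↔ x` or `v ↔ x`). -/
lemma mem_Q_inter_connL_update_true_iff {ends : E → Sym2 V} {g : E} {a₁ v : V}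
    (hg : ends g = s(a₁, v)) (ω : Config E) (a₂ x : V) :
    Function.update ω g true ∈ avoidAll ends a₂ {a₁} ∩ connEvent ends a₁ x ↔
      ω ∈ avoidAll ends a₂ {a₁} ∧ ¬ Conn ends ω a₂ v ∧ (Conn ends ω a₁ x ∨ Conn ends ω v x) := by
  rw [Set.mem_inter_iff, mem_Q_update_true_iff hg, mem_connEvent, conn_a₁_update_true_iff hg]
  tauto

omit [Fintype E] [DecidableEq V] in
/-- `ω[g ↦ open] ∈ Q ∩ ({a₂ ↔ y} ∩ {a₁ ↔ x})` iff `ω ∈ Q′`, `a₂ ↔ y`, and (`a₁ ↔ x` or `v ↔ x`). -/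
lemma mem_Q_inter_connH_connL_update_true_iff {ends : E → Sym2 V} {g : E} {a₁ v : V}
    (hg : ends g = s(a₁, v)) (ω : Config E) (a₂ x y : V) :
    Function.update ω g true ∈ avoidAll ends a₂ {a₁} ∩ (connEvent ends a₂ y ∩ connEvent ends a₁ x) ↔
      ω ∈ avoidAll ends a₂ {a₁} ∧ ¬ Conn ends ω a₂ v ∧ Conn ends ω a₂ y ∧
        (Conn ends ω a₁ x ∨ Conn ends ω v x) := by
  rw [Set.mem_inter_iff, Set.mem_inter_iff, mem_Q_update_true_iff hg, mem_connEvent,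
    mem_connEvent, conn_a₁_update_true_iff hg]
  constructor
  · rintro ⟨⟨hQ, hv⟩, hy, hx⟩
    exact ⟨hQ, hv, (conn_a₂_update_true_iff_of_Q' hg hQ hv y).1 hy, hx⟩
  · rintro ⟨hQ, hv, hy, hx⟩
    exact ⟨⟨hQ, hv⟩, (conn_a₂_update_true_iff_of_Q' hg hQ hv y).2 hy, hx⟩

/-! ## The eight cells of `(v ∈ C₂, o ∈ C₂, b ∈ C₁)` on `Q`, and the two `b ~ v` cells -/

/-- The cell `{[v ∈ C₂] = χ, [o ∈ C₂] = ω, [b ∈ C₁] = β}` (as a set of configurations). -/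
def cellSet (ends : E → Sym2 V) (a₁ a₂ b o v : V) (χ ω β : Bool) : Set (Config E) :=
  {ω' | (Conn ends ω' a₂ v ↔ χ = true) ∧ (Conn ends ω' a₂ o ↔ ω = true) ∧
    (Conn ends ω' a₁ b ↔ β = true)}

/-- `m(χ, ω, β) = P(Q, [v ∈ C₂] = χ, [o ∈ C₂] = ω, [b ∈ C₁] = β)`. -/
noncomputable def cell (p : E → R) (ends : E → Sym2 V) (a₁ a₂ b o v : V) (χ ω β : Bool) : R :=
  prob p (avoidAll ends a₂ {a₁} ∩ cellSet ends a₁ a₂ b o v χ ω β)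

/-- The `b ~ v` cells: `P(Q, v ∉ C₂, b ∉ C₁, v ↔ b, [o ∈ C₂] = ω)` (then `b, v ∉ C₁ ∪ C₂`). -/
noncomputable def bvcell (p : E → R) (ends : E → Sym2 V) (a₁ a₂ b o v : V) (ω : Bool) : R :=
  prob p (avoidAll ends a₂ {a₁} ∩ {ω' | ¬ Conn ends ω' a₂ v ∧ ¬ Conn ends ω' a₁ b ∧
    Conn ends ω' v b ∧ (Conn ends ω' a₂ o ↔ ω = true)})

omit [DecidableEq V] [LinearOrder R] [IsStrictOrderedRing R] in
/-- Splitting a probability along the eight cells. -/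
lemma prob_eq_sum_cells (p : E → R) (ends : E → Sym2 V) (a₁ a₂ b o v : V)
    (A : Set (Config E)) :
    prob p A =
      prob p (A ∩ cellSet ends a₁ a₂ b o v true true true) +
      prob p (A ∩ cellSet ends a₁ a₂ b o v true true false) +
      prob p (A ∩ cellSet ends a₁ a₂ b o v true false true) +
      prob p (A ∩ cellSet ends a₁ a₂ b o v true false false) +
      prob p (A ∩ cellSet ends a₁ a₂ b o v false true true) +
      prob p (A ∩ cellSet ends a₁ a₂ b o v false true false) +
      prob p (A ∩ cellSet ends a₁ a₂ b o v false false true) +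
      prob p (A ∩ cellSet ends a₁ a₂ b o v false false false) := by
  have e0 : A ∩ cellSet ends a₁ a₂ b o v true true true = A ∩ connEvent ends a₂ v ∩ connEvent ends a₂ o ∩ connEvent ends a₁ b := by
    ext ω'
    simp only [cellSet, Set.mem_inter_iff, Set.mem_setOf_eq, mem_connEvent, iff_true]
    tauto
  have e1 : A ∩ cellSet ends a₁ a₂ b o v true true false = A ∩ connEvent ends a₂ v ∩ connEvent ends a₂ o ∩ (connEvent ends a₁ b)ᶜ := by
    ext ω'
    simp only [cellSet, Set.mem_inter_iff, Set.mem_setOf_eq, Set.mem_compl_iff, mem_connEvent, Bool.false_eq_true, iff_false, iff_true]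
    tauto
  have e2 : A ∩ cellSet ends a₁ a₂ b o v true false true = A ∩ connEvent ends a₂ v ∩ (connEvent ends a₂ o)ᶜ ∩ connEvent ends a₁ b := by
    ext ω'
    simp only [cellSet, Set.mem_inter_iff, Set.mem_setOf_eq, Set.mem_compl_iff, mem_connEvent, Bool.false_eq_true, iff_false, iff_true]
    tauto
  have e3 : A ∩ cellSet ends a₁ a₂ b o v true false false = A ∩ connEvent ends a₂ v ∩ (connEvent ends a₂ o)ᶜ ∩ (connEvent ends a₁ b)ᶜ := by
    ext ω'
    simp only [cellSet, Set.mem_inter_iff, Set.mem_setOf_eq, Set.mem_compl_iff, mem_connEvent, Bool.false_eq_true, iff_false, iff_true]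
    tauto
  have e4 : A ∩ cellSet ends a₁ a₂ b o v false true true = A ∩ (connEvent ends a₂ v)ᶜ ∩ connEvent ends a₂ o ∩ connEvent ends a₁ b := by
    ext ω'
    simp only [cellSet, Set.mem_inter_iff, Set.mem_setOf_eq, Set.mem_compl_iff, mem_connEvent, Bool.false_eq_true, iff_false, iff_true]
    tauto
  have e5 : A ∩ cellSet ends a₁ a₂ b o v false true false = A ∩ (connEvent ends a₂ v)ᶜ ∩ connEvent ends a₂ o ∩ (connEvent ends a₁ b)ᶜ := by
    ext ω'
    simp only [cellSet, Set.mem_inter_iff, Set.mem_setOf_eq, Set.mem_compl_iff, mem_connEvent, Bool.false_eq_true, iff_false, iff_true]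
    tauto
  have e6 : A ∩ cellSet ends a₁ a₂ b o v false false true = A ∩ (connEvent ends a₂ v)ᶜ ∩ (connEvent ends a₂ o)ᶜ ∩ connEvent ends a₁ b := by
    ext ω'
    simp only [cellSet, Set.mem_inter_iff, Set.mem_setOf_eq, Set.mem_compl_iff, mem_connEvent, Bool.false_eq_true, iff_false, iff_true]
    tauto
  have e7 : A ∩ cellSet ends a₁ a₂ b o v false false false = A ∩ (connEvent ends a₂ v)ᶜ ∩ (connEvent ends a₂ o)ᶜ ∩ (connEvent ends a₁ b)ᶜ := by
    ext ω'
    simp only [cellSet, Set.mem_inter_iff, Set.mem_setOf_eq, Set.mem_compl_iff, mem_connEvent, Bool.false_eq_true, iff_false]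
    tauto
  rw [e0, e1, e2, e3, e4, e5, e6, e7]
  have h0 := prob_inter_add_prob_inter_compl p A (connEvent ends a₂ v)
  have h1 := prob_inter_add_prob_inter_compl p (A ∩ connEvent ends a₂ v) (connEvent ends a₂ o)
  have h2 := prob_inter_add_prob_inter_compl p (A ∩ (connEvent ends a₂ v)ᶜ) (connEvent ends a₂ o)
  have h3 := prob_inter_add_prob_inter_compl p (A ∩ connEvent ends a₂ v ∩ connEvent ends a₂ o)
    (connEvent ends a₁ b)
  have h4 := prob_inter_add_prob_inter_compl p (A ∩ connEvent ends a₂ v ∩ (connEvent ends a₂ o)ᶜ)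
    (connEvent ends a₁ b)
  have h5 := prob_inter_add_prob_inter_compl p (A ∩ (connEvent ends a₂ v)ᶜ ∩ connEvent ends a₂ o)
    (connEvent ends a₁ b)
  have h6 := prob_inter_add_prob_inter_compl p
    (A ∩ (connEvent ends a₂ v)ᶜ ∩ (connEvent ends a₂ o)ᶜ) (connEvent ends a₁ b)
  linear_combination -h0 - h1 - h2 - h3 - h4 - h5 - h6

/-! ## The masses as cell sums -/

omit [DecidableEq V] [LinearOrder R] [IsStrictOrderedRing R] in
/-- `P(Q)` as the sum of the eight cells. -/
lemma mass_Q (p : E → R) (ends : E → Sym2 V) (a₁ a₂ b o v : V) :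
    prob p (avoidAll ends a₂ {a₁}) =
      cell p ends a₁ a₂ b o v true true true + cell p ends a₁ a₂ b o v true true false + cell p ends a₁ a₂ b o v true false true + cell p ends a₁ a₂ b o v true false false + cell p ends a₁ a₂ b o v false true true + cell p ends a₁ a₂ b o v false true false + cell p ends a₁ a₂ b o v false false true + cell p ends a₁ a₂ b o v false false false := by
  rw [prob_eq_sum_cells p ends a₁ a₂ b o v]
  rfl

omit [DecidableEq V] [LinearOrder R] [IsStrictOrderedRing R] in
/-- `P(Q, b ∈ C₁)` = the four cells with `β = true`. -/
lemma mass_bL (p : E → R) (ends : E → Sym2 V) (a₁ a₂ b o v : V) :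
    prob p (avoidAll ends a₂ {a₁} ∩ connEvent ends a₁ b) =
      cell p ends a₁ a₂ b o v true true true + cell p ends a₁ a₂ b o v true false true + cell p ends a₁ a₂ b o v false true true + cell p ends a₁ a₂ b o v false false true := by
  rw [prob_eq_sum_cells p ends a₁ a₂ b o v]
  have e : ∀ χ ω β : Bool, (avoidAll ends a₂ {a₁} ∩ connEvent ends a₁ b) ∩ cellSet ends a₁ a₂ b o v χ ω β =
      if β = true then avoidAll ends a₂ {a₁} ∩ cellSet ends a₁ a₂ b o v χ ω β else ∅ := by
    intro χ ω β
    cases χ <;> cases ω <;> cases β <;>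
      · ext ω'
        simp only [Set.mem_inter_iff, Set.mem_empty_iff_false, cellSet, Set.mem_setOf_eq,
          mem_connEvent, Bool.false_eq_true, iff_false, iff_true, if_true,
          if_false]
        tauto
  simp only [e, Bool.false_eq_true,
    if_true, if_false, prob_empty, cell]
  ring

omit [DecidableEq V] [LinearOrder R] [IsStrictOrderedRing R] in
/-- `P(Q, o ∈ C₂)` = the four cells with `ω = true`. -/
lemma mass_oH (p : E → R) (ends : E → Sym2 V) (a₁ a₂ b o v : V) :
    prob p (avoidAll ends a₂ {a₁} ∩ connEvent ends a₂ o) =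
      cell p ends a₁ a₂ b o v true true true + cell p ends a₁ a₂ b o v true true false + cell p ends a₁ a₂ b o v false true true + cell p ends a₁ a₂ b o v false true false := by
  rw [prob_eq_sum_cells p ends a₁ a₂ b o v]
  have e : ∀ χ ω β : Bool, (avoidAll ends a₂ {a₁} ∩ connEvent ends a₂ o) ∩ cellSet ends a₁ a₂ b o v χ ω β =
      if ω = true then avoidAll ends a₂ {a₁} ∩ cellSet ends a₁ a₂ b o v χ ω β else ∅ := by
    intro χ ω β
    cases χ <;> cases ω <;> cases β <;>
      · ext ω'
        simp only [Set.mem_inter_iff, Set.mem_empty_iff_false, cellSet, Set.mem_setOf_eq,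
          mem_connEvent, Bool.false_eq_true, iff_false, iff_true, if_true,
          if_false]
        tauto
  simp only [e, Bool.false_eq_true,
    if_true, if_false, prob_empty, cell]
  ring

omit [DecidableEq V] [LinearOrder R] [IsStrictOrderedRing R] in
/-- `P(Q, o ∈ C₂, b ∈ C₁)` = the two cells with `ω = β = true`. -/
lemma mass_oHbL (p : E → R) (ends : E → Sym2 V) (a₁ a₂ b o v : V) :
    prob p (avoidAll ends a₂ {a₁} ∩ (connEvent ends a₂ o ∩ connEvent ends a₁ b)) =
      cell p ends a₁ a₂ b o v true true true + cell p ends a₁ a₂ b o v false true true := by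
  rw [prob_eq_sum_cells p ends a₁ a₂ b o v]
  have e : ∀ χ ω β : Bool, (avoidAll ends a₂ {a₁} ∩ (connEvent ends a₂ o ∩ connEvent ends a₁ b)) ∩ cellSet ends a₁ a₂ b o v χ ω β =
      if ω = true ∧ β = true then avoidAll ends a₂ {a₁} ∩ cellSet ends a₁ a₂ b o v χ ω β else ∅ := by
    intro χ ω β
    cases χ <;> cases ω <;> cases β <;>
      · ext ω'
        simp only [Set.mem_inter_iff, Set.mem_empty_iff_false, cellSet, Set.mem_setOf_eq,
          mem_connEvent, Bool.false_eq_true, iff_false, iff_true, if_true,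
          if_false, and_self, and_true, and_false]
        tauto
  simp only [e, Bool.false_eq_true, and_self,
    and_true, and_false, if_true, if_false, prob_empty, cell]
  ring

/-! ## The two candidate 5-mark inequalities (defs, NOT claimed proved) -/

/-- **(3M), a CANDIDATE (NOT claimed proved)**: in the cells `m(χ, ω, β) = P(Q, [v ∈ C₂] = χ,
[o ∈ C₂] = ω, [b ∈ C₁] = β)` of every product law,
`m(011)·m(100) + m(111)·m(000) ≤ m(101)·m(010) + m(001)·m(110)` — BHK06 Thm 1.4 for `(b ∈ C₁, o ∈ C₂)`
on `Q` minus the two BHK slacks of the worlds `{v ∈ C₂}` and `{v ∉ C₂}` is nonnegative.  Census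
(night-3 g21, exact rationals): 0 failures / 1,361 nonzero rows (n ≤ 7); not a degree-2 consequence
of the landed BHK / Harris / BK instances on the 5-mark table (LP, Farkas residual 18). -/
def ThreeMark (ends : E → Sym2 V) (a₁ a₂ b o v : V) : Prop :=
  ∀ (p : E → R), IsProbVec p →
    cell p ends a₁ a₂ b o v false true true * cell p ends a₁ a₂ b o v true false false +
        cell p ends a₁ a₂ b o v true true true * cell p ends a₁ a₂ b o v false false false ≤
      cell p ends a₁ a₂ b o v true false true * cell p ends a₁ a₂ b o v false true false +
        cell p ends a₁ a₂ b o v false false true * cell p ends a₁ a₂ b o v true true false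

/-- **(F), a CANDIDATE (NOT claimed proved)**: `P(Q, v ∈ C₂)·P(Q, o ∈ C₂, b ~ v) ≤
P(Q, v ∈ C₂, o ∈ C₂)·P(Q, b ~ v)` for every product law (`b ~ v` = `b, v` in one cluster outside
`C₁ ∪ C₂`): conditional on `Q`, `o ∈ C₂` is at least as likely given `v ∈ C₂` as given `b ~ v`.
Census (night-3 g21, exact): 0 failures / 1,909 nonzero rows (n ≤ 7); the unconditioned twin
`P(Q, oH)P(Q, b~v) ≥ P(Q)P(Q, oH, b~v)` is FALSE (n = 5 witness, §30). -/
def BVCross (ends : E → Sym2 V) (a₁ a₂ b o v : V) : Prop :=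
  ∀ (p : E → R), IsProbVec p →
    (cell p ends a₁ a₂ b o v true true true + cell p ends a₁ a₂ b o v true true false +
          cell p ends a₁ a₂ b o v true false true + cell p ends a₁ a₂ b o v true false false) *
        bvcell p ends a₁ a₂ b o v true ≤
      (cell p ends a₁ a₂ b o v true true true + cell p ends a₁ a₂ b o v true true false) *
        (bvcell p ends a₁ a₂ b o v true + bvcell p ends a₁ a₂ b o v false)

end RootEdge

end CovForm

end Summit.Ventures.PercRepro2
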